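import Mathlib
import HarnessLib
import Literature.Probability.MarkovChains.ContractionSpectralGap

/-!
# Coupling characterisation of total variation: `‖μ − ν‖_TV = min P{X ≠ Y}` and the optimal coupling (Levin–Peres–Wilmer Prop. 4.7, Remark 4.8)

HONEST FRAMING: exact (Metropolis-corrected) sampling algorithms for lattice gauge theory; figures
of merit are autocorrelation/cost numbers at stated couplings and volumes; no continuum-physics claim.

Conventions of `TotalVariation.lean` (`tvDist μ ν = ½ Σ_x |μ(x) − ν(x)|`, `tvDist_eq_sum_filter` =
eq. (4.5)) and `ContractionSpectralGap.lean` (`IsCoupling μ ν q`: a coupling given by a joint law `q`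
on `X × X`, `q ≥ 0`, `Σ_y q(x,y) = μ(x)`, `Σ_x q(x,y) = ν(y)`).  For a coupling `q`,
`P{X ≠ Y} = Σ_a Σ_{b ≠ a} q(a,b)`, written `∑ a, ∑ b ∈ univ.erase a, q a b`.  Source: D. A. Levin,
Y. Peres (with E. L. Wilmer), *Markov Chains and Mixing Times*, 2nd ed., AMS 2017 [LevinPeres2017],
§4.2 pp. 50–52.  Everything is PROVED (finite sums; 0 named facts).

* `IsCoupling.sum_eq` (the marginals have equal mass), `IsCoupling.sum_offDiag_eq`
  (`P{X ≠ Y} = Σ μ − Σ_a q(a,a)`);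
* **(4.9)–(4.11)** `IsCoupling.sub_sum_eq` — `μ(A) − ν(A) = P{X ∈ A, Y ∉ A} − P{X ∉ A, Y ∈ A}`,
  `IsCoupling.sub_sum_le` — `μ(A) − ν(A) ≤ P{X ∈ A, Y ∉ A}`, `IsCoupling.sum_sum_compl_le_offDiag` —
  `P{X ∈ A, Y ∉ A} ≤ P{X ≠ Y}` [cite: LevinPeres2017, §4.2 Prop. 4.7 (proof, eqs. (4.9)–(4.11))];
* **(4.12)** `LevinPeres2017_prop_4_7_le` — for EVERY coupling, **`‖μ − ν‖_TV ≤ P{X ≠ Y}`** (and the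
  form `≤ 1 − Σ_a q(a,a)` for probability vectors) [cite: LevinPeres2017, §4.2 eq. (4.12)];
* **(4.13)** `sum_min_eq_one_sub_tvDist` — `Σ_x μ(x) ∧ ν(x) = 1 − ‖μ − ν‖_TV`
  [cite: LevinPeres2017, §4.2 eq. (4.13)];
* `optimalCoupling μ ν` — the coupling of the proof of Prop. 4.7 / **Remark 4.8**: with
  `p = Σ μ ∧ ν`, `γ_III = (μ ∧ ν)/p` on the diagonal with weight `p`, and with weight `1 − p = ‖μ − ν‖_TV`
  the product of `γ_I = (μ − ν)⁺/‖μ − ν‖_TV` and `γ_II = (ν − μ)⁺/‖μ − ν‖_TV`; written out,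
  `q(x,y) = 𝟙{x = y} (μ ∧ ν)(x) + (μ(x) − (μ ∧ ν)(x)) (ν(y) − (μ ∧ ν)(y)) / ‖μ − ν‖_TV`
  (`(μ − ν)⁺ = μ − μ ∧ ν`; for `μ = ν` the second term vanishes and `q` is the diagonal coupling —
  the coin "lands heads" with probability `p = 1`) [cite: LevinPeres2017, §4.2 proof of Prop. 4.7,
  steps (i)–(ii), pp. 51–52];
  `optimalCoupling_isCoupling` ("`pγ_III + (1−p)γ_I = μ`, `pγ_III + (1−p)γ_II = ν`"),
  `optimalCoupling_self` (`q(x,x) = μ(x) ∧ ν(x)`), `sum_optimalCoupling_offDiag` —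
  **`P{X ≠ Y} = ‖μ − ν‖_TV`** [cite: LevinPeres2017, §4.2 proof of Prop. 4.7, last display];
* **PROPOSITION 4.7 with REMARK 4.8** `LevinPeres2017_prop_4_7` — `‖μ − ν‖_TV` is the LEAST element
  of `{P{X ≠ Y} : (X,Y) a coupling of μ and ν}` (the infimum (4.8) is attained), and
  `LevinPeres2017_eq_4_8` — **`‖μ − ν‖_TV = inf {P{X ≠ Y} : (X,Y) a coupling of μ and ν}`**
  [cite: LevinPeres2017, §4.2 Prop. 4.7 eq. (4.8), Remark 4.8].

Related, in another vocabulary: `Literature.Probability.Percolation.exists_coupling_of_finite_range`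
(measure-theoretic, two probability spaces, bound `P[X ≠ Y] ≤ Σ |p − q|` without the factor `½` and
without optimality).  The present file is the finite `X → ℝ` version used by the Markov-chain files
(`MixingTimeSubmultiplicative.lean` lists Prop. 4.7 as "Not here").

Context (cell pub-lqcd, venture LatticeQCDFlow): coupling bounds `d(t) ≤ max_{x,y} P{X_t ≠ Y_t}`
(Thm. 5.4 / Cor. 5.5 of the book) rest on (4.12); the optimal coupling is the sharpness statement.
-/

namespace Literature.Probability.MarkovChains

open Finset

variable {X : Type*} [Fintype X] [DecidableEq X]

section AnyCoupling

variable {μ ν : X → ℝ} {q : X → X → ℝ}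

omit [DecidableEq X] in
/-- The two marginals of a coupling have the same total mass: `Σ μ = Σ_{a,b} q(a,b) = Σ ν`.
[cite: LevinPeres2017, §4.2 (the two marginal identities of a coupling `q`)] -/
theorem IsCoupling.sum_eq (hq : IsCoupling μ ν q) : ∑ a, μ a = ∑ b, ν b := by
  obtain ⟨-, h1, h2⟩ := hq
  calc ∑ a, μ a = ∑ a, ∑ b, q a b := sum_congr rfl fun a _ => (h1 a).symm
    _ = ∑ b, ∑ a, q a b := sum_comm
    _ = ∑ b, ν b := sum_congr rfl fun b _ => h2 b

/-- `P{X ≠ Y} = Σ_a Σ_{b ≠ a} q(a,b) = Σ_a μ(a) − Σ_a q(a,a)` (`= 1 − P{X = Y}` for a probability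
vector `μ`). [cite: LevinPeres2017, §4.2 (a coupling specified by its joint law `q`)] -/
theorem IsCoupling.sum_offDiag_eq (hq : IsCoupling μ ν q) :
    ∑ a, ∑ b ∈ univ.erase a, q a b = ∑ a, μ a - ∑ a, q a a := by
  obtain ⟨-, h1, -⟩ := hq
  rw [← sum_sub_distrib]
  exact sum_congr rfl fun a _ => by rw [sum_erase_eq_sub (mem_univ a), h1 a]

/-- **(4.9)**: `μ(A) − ν(A) = P{X ∈ A} − P{Y ∈ A} = P{X ∈ A, Y ∉ A} − P{X ∉ A, Y ∈ A}`.
[cite: LevinPeres2017, §4.2 Prop. 4.7 (proof, eq. (4.9) and the parenthetical remark after (4.11))] -/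
theorem IsCoupling.sub_sum_eq (hq : IsCoupling μ ν q) (A : Finset X) :
    ∑ x ∈ A, μ x - ∑ x ∈ A, ν x = ∑ a ∈ A, ∑ b ∈ Aᶜ, q a b - ∑ a ∈ Aᶜ, ∑ b ∈ A, q a b := by
  obtain ⟨-, h1, h2⟩ := hq
  have hX : ∑ x ∈ A, μ x = ∑ a ∈ A, ∑ b ∈ A, q a b + ∑ a ∈ A, ∑ b ∈ Aᶜ, q a b := by
    rw [← sum_add_distrib]
    exact sum_congr rfl fun a _ => by rw [sum_add_sum_compl, h1 a]
  have hY : ∑ x ∈ A, ν x = ∑ a ∈ A, ∑ b ∈ A, q a b + ∑ a ∈ Aᶜ, ∑ b ∈ A, q a b := by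
    have h : ∑ b ∈ A, ν b = ∑ b ∈ A, (∑ a ∈ A, q a b + ∑ a ∈ Aᶜ, q a b) :=
      sum_congr rfl fun b _ => by rw [sum_add_sum_compl, h2 b]
    rw [h, sum_add_distrib]
    congr 1 <;> exact sum_comm
  rw [hX, hY]; ring

/-- **(4.10)**: `μ(A) − ν(A) ≤ P{X ∈ A, Y ∉ A}` ("dropping the event `{X ∉ A, Y ∈ A}`").
[cite: LevinPeres2017, §4.2 Prop. 4.7 (proof, eq. (4.10))] -/
theorem IsCoupling.sub_sum_le (hq : IsCoupling μ ν q) (A : Finset X) :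
    ∑ x ∈ A, μ x - ∑ x ∈ A, ν x ≤ ∑ a ∈ A, ∑ b ∈ Aᶜ, q a b := by
  rw [hq.sub_sum_eq A]
  have h0 : 0 ≤ ∑ a ∈ Aᶜ, ∑ b ∈ A, q a b := sum_nonneg fun a _ => sum_nonneg fun b _ => hq.1 a b
  linarith

/-- **(4.11)**: `P{X ∈ A, Y ∉ A} ≤ P{X ≠ Y}`. [cite: LevinPeres2017, §4.2 Prop. 4.7 (proof,
eq. (4.11))] -/
theorem IsCoupling.sum_sum_compl_le_offDiag (hq : IsCoupling μ ν q) (A : Finset X) :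
    ∑ a ∈ A, ∑ b ∈ Aᶜ, q a b ≤ ∑ a, ∑ b ∈ univ.erase a, q a b :=
  calc ∑ a ∈ A, ∑ b ∈ Aᶜ, q a b ≤ ∑ a ∈ A, ∑ b ∈ univ.erase a, q a b := by
        refine sum_le_sum fun a ha => sum_le_sum_of_subset_of_nonneg ?_ fun b _ _ => hq.1 a b
        intro b hb
        rw [mem_compl] at hb
        exact mem_erase.2 ⟨fun h => hb (h ▸ ha), mem_univ b⟩
    _ ≤ ∑ a, ∑ b ∈ univ.erase a, q a b :=
        sum_le_sum_of_subset_of_nonneg (subset_univ A) fun a _ _ => sum_nonneg fun b _ => hq.1 a b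

/-- **(4.12)**: for every coupling `(X,Y)` of `μ` and `ν`, **`‖μ − ν‖_TV ≤ P{X ≠ Y}`**
(take `A = {x : μ(x) ≥ ν(x)}` in (4.9)–(4.11), with (4.5)). [cite: LevinPeres2017, §4.2 Prop. 4.7,
eq. (4.12)] -/
theorem LevinPeres2017_prop_4_7_le (hq : IsCoupling μ ν q) :
    tvDist μ ν ≤ ∑ a, ∑ b ∈ univ.erase a, q a b := by
  rw [tvDist_eq_sum_filter hq.sum_eq, sum_sub_distrib]
  exact (hq.sub_sum_le _).trans (hq.sum_sum_compl_le_offDiag _)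

/-- (4.12) in the form `‖μ − ν‖_TV ≤ 1 − P{X = Y} = 1 − Σ_a q(a,a)` for a probability vector `μ`.
[cite: LevinPeres2017, §4.2 Prop. 4.7, eq. (4.12)] -/
theorem LevinPeres2017_prop_4_7_le_one_sub (hq : IsCoupling μ ν q) (hμ1 : ∑ a, μ a = 1) :
    tvDist μ ν ≤ 1 - ∑ a, q a a := by
  have h := LevinPeres2017_prop_4_7_le hq
  rwa [hq.sum_offDiag_eq, hμ1] at h

omit [DecidableEq X] in
/-- **(4.13)**: `Σ_x μ(x) ∧ ν(x) = 1 − ‖μ − ν‖_TV` for probability vectors (the area of "region III").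
[cite: LevinPeres2017, §4.2 eq. (4.13) (with Figure 4.2)] -/
theorem sum_min_eq_one_sub_tvDist (hμ1 : ∑ x, μ x = 1) (hν1 : ∑ x, ν x = 1) :
    ∑ x, min (μ x) (ν x) = 1 - tvDist μ ν := by
  unfold tvDist
  have h : ∀ x, min (μ x) (ν x) = (μ x + ν x - |μ x - ν x|) / 2 := fun x => by
    rcases le_total (μ x) (ν x) with hle | hle
    · rw [min_eq_left hle, abs_of_nonpos (sub_nonpos.2 hle)]; ring
    · rw [min_eq_right hle, abs_of_nonneg (sub_nonneg.2 hle)]; ring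
  simp_rw [h]
  rw [← sum_div, sum_sub_distrib, sum_add_distrib, hμ1, hν1]
  ring

omit [DecidableEq X] in
/-- `γ_I` has mass one: `Σ_x (μ(x) − μ(x) ∧ ν(x)) = Σ_x (μ(x) − ν(x))⁺ = ‖μ − ν‖_TV` ("(4.5) ensures
that `γ_I` … is a probability distribution"). [cite: LevinPeres2017, §4.2 proof of Prop. 4.7,
step (ii) with eqs. (4.5), (4.13)] -/
theorem sum_sub_min_left (hμ1 : ∑ x, μ x = 1) (hν1 : ∑ x, ν x = 1) :
    ∑ x, (μ x - min (μ x) (ν x)) = tvDist μ ν := by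
  rw [sum_sub_distrib, hμ1, sum_min_eq_one_sub_tvDist hμ1 hν1]; ring

omit [DecidableEq X] in
/-- `γ_II` has mass one: `Σ_y (ν(y) − μ(y) ∧ ν(y)) = ‖μ − ν‖_TV`. [cite: LevinPeres2017, §4.2 proof
of Prop. 4.7, step (ii) with eqs. (4.5), (4.13)] -/
theorem sum_sub_min_right (hμ1 : ∑ x, μ x = 1) (hν1 : ∑ x, ν x = 1) :
    ∑ y, (ν y - min (μ y) (ν y)) = tvDist μ ν := by
  rw [sum_sub_distrib, hν1, sum_min_eq_one_sub_tvDist hμ1 hν1]; ring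

end AnyCoupling

section Optimal

/-- `(a − a ∧ b)(b − a ∧ b) = 0`: `γ_I` and `γ_II` "are positive on disjoint subsets of `X`".
[cite: LevinPeres2017, §4.2 proof of Prop. 4.7 (last paragraph)] -/
theorem sub_min_mul_sub_min_self (a b : ℝ) : (a - min a b) * (b - min a b) = 0 := by
  rcases le_total a b with h | h
  · rw [min_eq_left h, sub_self, zero_mul]
  · rw [min_eq_right h, sub_self, mul_zero]

/-- The OPTIMAL COUPLING of `μ` and `ν` (as a joint law on `X × X`):
`q(x,y) = 𝟙{x = y} (μ ∧ ν)(x) + (μ(x) − (μ ∧ ν)(x)) (ν(y) − (μ ∧ ν)(y)) / ‖μ − ν‖_TV`, i.e. with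
probability `p = 1 − ‖μ − ν‖_TV` set `X = Y = Z ∼ γ_III = (μ ∧ ν)/p`, otherwise draw independently
`X ∼ γ_I = (μ − ν)⁺/‖μ − ν‖_TV`, `Y ∼ γ_II = (ν − μ)⁺/‖μ − ν‖_TV`.  (For `μ = ν` the second term is
`0` and `q` is the diagonal coupling.) [cite: LevinPeres2017, §4.2 proof of Prop. 4.7 steps (i)–(ii)
and Remark 4.8 ("optimal coupling"), pp. 51–52] -/
noncomputable def optimalCoupling (μ ν : X → ℝ) (x y : X) : ℝ :=
  (if x = y then min (μ x) (ν x) else 0) +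
    (μ x - min (μ x) (ν x)) * (ν y - min (μ y) (ν y)) / tvDist μ ν

variable {μ ν : X → ℝ}

/-- On the diagonal the optimal coupling is `μ ∧ ν` ("`X = Y` if and only if the coin toss is
heads"). [cite: LevinPeres2017, §4.2 proof of Prop. 4.7 (last paragraph)] -/
theorem optimalCoupling_self (μ ν : X → ℝ) (x : X) : optimalCoupling μ ν x x = min (μ x) (ν x) := by
  rw [optimalCoupling, if_pos rfl, sub_min_mul_sub_min_self, zero_div, add_zero]

/-- Off the diagonal the optimal coupling is `(1 − p) γ_I(x) γ_II(y)`.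
[cite: LevinPeres2017, §4.2 proof of Prop. 4.7 step (ii)] -/
theorem optimalCoupling_of_ne (μ ν : X → ℝ) {x y : X} (h : x ≠ y) :
    optimalCoupling μ ν x y = (μ x - min (μ x) (ν x)) * (ν y - min (μ y) (ν y)) / tvDist μ ν := by
  rw [optimalCoupling, if_neg h, zero_add]

/-- The optimal coupling is nonnegative for nonnegative `μ, ν`. [cite: LevinPeres2017, §4.2 proof
of Prop. 4.7 steps (i)–(ii)] -/
theorem optimalCoupling_nonneg (hμ : ∀ x, 0 ≤ μ x) (hν : ∀ x, 0 ≤ ν x) (x y : X) :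
    0 ≤ optimalCoupling μ ν x y := by
  unfold optimalCoupling
  refine add_nonneg ?_ (div_nonneg (mul_nonneg (sub_nonneg.2 (min_le_left _ _))
    (sub_nonneg.2 (min_le_right _ _))) (tvDist_nonneg _ _))
  split_ifs
  · exact le_min (hμ x) (hν x)
  · exact le_rfl

/-- First marginal: `Σ_y q(x,y) = μ(x)` ("`pγ_III + (1 − p)γ_I = μ`"). [cite: LevinPeres2017, §4.2
proof of Prop. 4.7 (the display after step (ii))] -/
theorem sum_optimalCoupling_right (hμ1 : ∑ x, μ x = 1) (hν1 : ∑ x, ν x = 1) (x : X) :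
    ∑ y, optimalCoupling μ ν x y = μ x := by
  simp only [optimalCoupling, sum_add_distrib, sum_ite_eq, mem_univ, if_true]
  rw [← sum_div, ← mul_sum, sum_sub_min_right hμ1 hν1]
  by_cases h0 : tvDist μ ν = 0
  · rw [h0, div_zero, add_zero, (tvDist_eq_zero_iff μ ν).1 h0, min_self]
  · rw [mul_div_cancel_right₀ _ h0]; ring

/-- Second marginal: `Σ_x q(x,y) = ν(y)` ("`pγ_III + (1 − p)γ_II = ν`"). [cite: LevinPeres2017, §4.2
proof of Prop. 4.7 (the display after step (ii))] -/
theorem sum_optimalCoupling_left (hμ1 : ∑ x, μ x = 1) (hν1 : ∑ x, ν x = 1) (y : X) :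
    ∑ x, optimalCoupling μ ν x y = ν y := by
  simp only [optimalCoupling, sum_add_distrib, sum_ite_eq', mem_univ, if_true]
  rw [← sum_div, ← sum_mul, sum_sub_min_left hμ1 hν1]
  by_cases h0 : tvDist μ ν = 0
  · rw [h0, div_zero, add_zero, (tvDist_eq_zero_iff μ ν).1 h0, min_self]
  · rw [mul_div_cancel_left₀ _ h0]; ring

/-- The optimal coupling IS a coupling of `μ` and `ν`. [cite: LevinPeres2017, §4.2 proof of
Prop. 4.7 ("so that the distribution of `X` is `μ` and the distribution of `Y` is `ν`")] -/
theorem optimalCoupling_isCoupling (hμ : ∀ x, 0 ≤ μ x) (hν : ∀ x, 0 ≤ ν x) (hμ1 : ∑ x, μ x = 1)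
    (hν1 : ∑ x, ν x = 1) : IsCoupling μ ν (optimalCoupling μ ν) :=
  ⟨optimalCoupling_nonneg hμ hν, sum_optimalCoupling_right hμ1 hν1,
    sum_optimalCoupling_left hμ1 hν1⟩

/-- For the optimal coupling **`P{X ≠ Y} = ‖μ − ν‖_TV`**. [cite: LevinPeres2017, §4.2 proof of
Prop. 4.7 (last display "`P{X ≠ Y} = ‖μ − ν‖_TV`")] -/
theorem sum_optimalCoupling_offDiag (hμ : ∀ x, 0 ≤ μ x) (hν : ∀ x, 0 ≤ ν x) (hμ1 : ∑ x, μ x = 1)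
    (hν1 : ∑ x, ν x = 1) : ∑ a, ∑ b ∈ univ.erase a, optimalCoupling μ ν a b = tvDist μ ν := by
  rw [(optimalCoupling_isCoupling hμ hν hμ1 hν1).sum_offDiag_eq, hμ1]
  simp_rw [optimalCoupling_self]
  rw [sum_min_eq_one_sub_tvDist hμ1 hν1]; ring

/-- **PROPOSITION 4.7 with REMARK 4.8.** For probability vectors `μ, ν` on a finite `X`,
`‖μ − ν‖_TV` is the least element of `{P{X ≠ Y} : (X,Y) a coupling of μ and ν}`: every coupling has
`P{X ≠ Y} ≥ ‖μ − ν‖_TV` and the optimal coupling attains it. [cite: LevinPeres2017, §4.2 Prop. 4.7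
eq. (4.8) and Remark 4.8] -/
theorem LevinPeres2017_prop_4_7 (hμ : ∀ x, 0 ≤ μ x) (hν : ∀ x, 0 ≤ ν x) (hμ1 : ∑ x, μ x = 1)
    (hν1 : ∑ x, ν x = 1) :
    IsLeast {r : ℝ | ∃ q : X → X → ℝ, IsCoupling μ ν q ∧ ∑ a, ∑ b ∈ univ.erase a, q a b = r}
      (tvDist μ ν) := by
  refine ⟨⟨optimalCoupling μ ν, optimalCoupling_isCoupling hμ hν hμ1 hν1,
    sum_optimalCoupling_offDiag hμ hν hμ1 hν1⟩, ?_⟩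
  rintro r ⟨q, hq, rfl⟩
  exact LevinPeres2017_prop_4_7_le hq

/-- **(4.8)**: `‖μ − ν‖_TV = inf {P{X ≠ Y} : (X,Y) is a coupling of μ and ν}`.
[cite: LevinPeres2017, §4.2 Prop. 4.7 eq. (4.8)] -/
theorem LevinPeres2017_eq_4_8 (hμ : ∀ x, 0 ≤ μ x) (hν : ∀ x, 0 ≤ ν x) (hμ1 : ∑ x, μ x = 1)
    (hν1 : ∑ x, ν x = 1) :
    tvDist μ ν =
      sInf {r : ℝ | ∃ q : X → X → ℝ, IsCoupling μ ν q ∧ ∑ a, ∑ b ∈ univ.erase a, q a b = r} :=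
  (LevinPeres2017_prop_4_7 hμ hν hμ1 hν1).csInf_eq.symm

end Optimal

end Literature.Probability.MarkovChains
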